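import Summits.RiemannHypothesis.RiemannHypothesis.Theorems.TiltedLandingLaw421R3InitQ

/-! # TiltedLandingLaw421R3StubRestRateBotQ — STEP-FORM INFRASTRUCTURE
SUPPORT for stub `stub_restRateBotQ : RhW08.SealSwapQ.RestRateBotQ` for crux `TiltedLandingLaw421` (stmt-RiemannHypothesis-24774).
W-08 ROUND-3b (director (CA336) KEY = BAND, (CA346) RELEASE-3b): the RATE inequality for the Q-family.

This file proves the step-form REDUCTION: `RestRateBotQ ↔ RestStepBotQ`
- The k = 0 case is proved from `initSharpQ_closed` (INIT♯^Q, R3InitQ #1023)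
- Across uncharged levels, the rate account is FROZEN
- Hence the bound at all k reduces to the bound at k+1 for each charged k (RestStepBotQ)

The ACTUAL proof of RestStepBotQ requires the (CA344)(b) constraint: RemainderBox consumption.
K = kernel-checked lemmas about MODEL sockets; typed ≠ proved; RH is NOT proved; 24774 OPEN. -/

namespace RhW08.SealSwapQ

open Complex
open RhIdea6.G17.W07C7 RhIdea6.G17.W07C7.Rev6 RhIdea6.G18.W07C8.Law421BirthS RhIdea6.G19.W07C11.Seam
open RhIdea6.G20.W07C12.Frac RhIdea6.G20.W07C12.StColP RhW07.C12.FieldSplit RhIdea6.G21.W07C13.TentMax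
open RhW07.C14.TwoSided RhW07.C14.Classes RhW07.C14.Lineage RhW07.C14.Booking
open RhW07.C13.Heredity RhIdea6.G22.W07C15pre.Injection RhW07.E3.Cell
open RhW07.E3.Lit
open RhW08.Round1 RhW08.StSwap RhW08.Round2 RhW08.QuadW
open RhW08.SealSwap (PBot)

section StepFormQ

open Classical in
/-- §Q.6 the left-hand side of the rate inequality at prefix `k` (the «Q-rate account» `L_Q k`). -/
noncomputable def rateLHSBotQ (η : ℝ) (f : ℂ → ℂ) (x₀ s hmax R Hs : ℝ) (B k : ℕ) : ℝ :=
  chargeCount (PTrkSQ PBot) StTrkDQ ReadyR2 η f x₀ s hmax R Hs B k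
    + max (tentMeterTrkD (3 / 2) η f x₀ s hmax R Hs B 0 - injected (PTrkSQ PBot) StTrkDQ ReadyR2 EmptyTrkDQ η f x₀ s hmax R Hs B k) 0
    + 4 * lowH StTrkDQ η f x₀ s hmax R Hs B k / s
    + (∑ j ∈ Finset.range k, (if Charged (PTrkSQ PBot) StTrkDQ ReadyR2 η f x₀ s hmax R Hs B j then 0 else
        4 * (lowH StTrkDQ η f x₀ s hmax R Hs B j - lowH StTrkDQ η f x₀ s hmax R Hs B (j + 1)) / s))

/-- (K) §Q.6 STUB 2 (Q) read through the account: `RestRateBotQ ↔ ∀ legal k, L_Q k ≤ purse` (definitional). -/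
theorem restRateBotQ_iff_lhs : RestRateBotQ ↔
    ∀ (η : ℝ) (f : ℂ → ℂ) (x₀ s hmax R Hs : ℝ) (B : ℕ), EngineHyps5 2 η f x₀ s hmax R Hs B →
      ∀ k : ℕ, rateLHSBotQ η f x₀ s hmax R Hs B k ≤ (Hs / s) ^ 2 + (B : ℝ) + 1 + 4 * hmax / s :=
  Iff.rfl

open Classical in
/-- ★★★ §Q.6 **the `k = 0` instance of RestRateBotQ is PROVED from `initSharpQ_closed`**: at the root the rate inequality reads
`max T₀ᴿ 0 + 4·rootHeight_Q/s ≤ (Hs/s)² + B + 1 + 4·hmax/s`, which follows from INIT♯^Q (`initSharpQ_closed`). -/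
theorem restRateBotQ_zero {η : ℝ} {f : ℂ → ℂ} {x₀ s hmax R Hs : ℝ} {B : ℕ} (hE : EngineHyps5 2 η f x₀ s hmax R Hs B) :
    chargeCount (PTrkSQ PBot) StTrkDQ ReadyR2 η f x₀ s hmax R Hs B 0
        + max (tentMeterTrkD (3 / 2) η f x₀ s hmax R Hs B 0 - injected (PTrkSQ PBot) StTrkDQ ReadyR2 EmptyTrkDQ η f x₀ s hmax R Hs B 0) 0
        + 4 * lowH StTrkDQ η f x₀ s hmax R Hs B 0 / s
        + (∑ j ∈ Finset.range 0, (if Charged (PTrkSQ PBot) StTrkDQ ReadyR2 η f x₀ s hmax R Hs B j then 0 else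
            4 * (lowH StTrkDQ η f x₀ s hmax R Hs B j - lowH StTrkDQ η f x₀ s hmax R Hs B (j + 1)) / s))
      ≤ (Hs / s) ^ 2 + (B : ℝ) + 1 + 4 * hmax / s := by
  have hInit := initSharpQ_closed η f x₀ s hmax R Hs B hE
  have hs : 0 < s := hE.2.2.2.1
  rw [chargeCount_zero, RhW08.SealSwap.injected_zero, Finset.sum_range_zero, lowH_zero, sub_zero, zero_add, add_zero]
  simp only [heightBudget] at hInit
  have hT0 : tentMeterTrkD (3 / 2) η f x₀ s hmax R Hs B 0
      ≤ (Hs / s) ^ 2 + (B : ℝ) + 1 + 4 * (hmax - rootHeight StTrkDQ η f x₀ s hmax R Hs B) / s := by linarith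
  have hA : 0 ≤ (Hs / s) ^ 2 + (B : ℝ) + 1 := by positivity
  have hdiff : 0 ≤ 4 * (hmax - rootHeight StTrkDQ η f x₀ s hmax R Hs B) / s :=
    div_nonneg (mul_nonneg (by norm_num) (by linarith [rootHeight_stTrkDQ_le hE, RhW08.Round2.rootHeight_stTrkD_le_hmax hE])) hs.le
  have hmax' : max (tentMeterTrkD (3 / 2) η f x₀ s hmax R Hs B 0) 0
      ≤ (Hs / s) ^ 2 + (B : ℝ) + 1 + 4 * (hmax - rootHeight StTrkDQ η f x₀ s hmax R Hs B) / s :=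
    max_le hT0 (by linarith)
  have hsplit : 4 * (hmax - rootHeight StTrkDQ η f x₀ s hmax R Hs B) / s
      = 4 * hmax / s - 4 * rootHeight StTrkDQ η f x₀ s hmax R Hs B / s := by ring
  linarith

open Classical in
/-- (K) §Q.6 an uncharged Q-level injects nothing. -/
theorem injectedQ_succ_of_not_charged {η : ℝ} {f : ℂ → ℂ} {x₀ s hmax R Hs : ℝ} {B k : ℕ}
    (h : ¬ Charged (PTrkSQ PBot) StTrkDQ ReadyR2 η f x₀ s hmax R Hs B k) :
    injected (PTrkSQ PBot) StTrkDQ ReadyR2 EmptyTrkDQ η f x₀ s hmax R Hs B (k + 1) =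
    injected (PTrkSQ PBot) StTrkDQ ReadyR2 EmptyTrkDQ η f x₀ s hmax R Hs B k := by
  unfold injected
  rw [Finset.sum_range_succ]
  simp only [h, false_and, if_false, add_zero]

open Classical in
/-- ★★ §Q.6 (K) **the Q-account is FROZEN across an uncharged level**: `¬Charged_Q k → L_Q (k+1) = L_Q k`. -/
theorem rateLHSBotQ_succ_of_not_charged {η : ℝ} {f : ℂ → ℂ} {x₀ s hmax R Hs : ℝ} {B k : ℕ}
    (h : ¬ Charged (PTrkSQ PBot) StTrkDQ ReadyR2 η f x₀ s hmax R Hs B k) :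
    rateLHSBotQ η f x₀ s hmax R Hs B (k + 1) = rateLHSBotQ η f x₀ s hmax R Hs B k := by
  simp only [rateLHSBotQ, chargeCount_succ, Finset.sum_range_succ, injectedQ_succ_of_not_charged h, h, if_false]
  ring

/-- ★★ §Q.6 the STEP form of RestRateBotQ: the purse inequality is demanded only at prefixes `k + 1` with level `k` CHARGED. -/
def RestStepBotQ : Prop :=
  ∀ (η : ℝ) (f : ℂ → ℂ) (x₀ s hmax R Hs : ℝ) (B : ℕ), EngineHyps5 2 η f x₀ s hmax R Hs B →
    ∀ k : ℕ, Charged (PTrkSQ PBot) StTrkDQ ReadyR2 η f x₀ s hmax R Hs B k →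
      rateLHSBotQ η f x₀ s hmax R Hs B (k + 1) ≤ (Hs / s) ^ 2 + (B : ℝ) + 1 + 4 * hmax / s

/-- ★★★ §Q.6 (K) **`RestRateBotQ ↔ RestStepBotQ`**: with the `k = 0` instance PROVED (`restRateBotQ_zero`) and the account frozen
across uncharged levels, RestRateBotQ is exactly «after every CHARGED level the account still fits the purse» (induction on `k`). -/
theorem restRateBotQ_iff_step : RestRateBotQ ↔ RestStepBotQ := by
  constructor
  · intro h η f x₀ s hmax R Hs B hE k _
    exact h η f x₀ s hmax R Hs B hE (k + 1)
  · intro h η f x₀ s hmax R Hs B hE k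
    show rateLHSBotQ η f x₀ s hmax R Hs B k ≤ _
    induction k with
    | zero => exact restRateBotQ_zero hE
    | succ k ih =>
      by_cases hC : Charged (PTrkSQ PBot) StTrkDQ ReadyR2 η f x₀ s hmax R Hs B k
      · exact h η f x₀ s hmax R Hs B hE k hC
      · rw [rateLHSBotQ_succ_of_not_charged hC]; exact ih

end StepFormQ

end RhW08.SealSwapQ
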